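import Summits.HodgeConjecture.CorCM.IrreducibleOddWeightsShadowIdealsCMFields
import HarnessLib

/-!
# Shadow ideals, VI: two types of ONE CM field — additive iff no equivariant endomorphisms collide the type vectors
# (any field); for a GALOIS field iff `span{u_Φ ∘ δ} ∩ span{u_Ψ ∘ δ} = 0`; for an ABELIAN field iff
# `Σ_z u_Φ(z)·u_Ψ(z ∘ δ) = 0` for every `δ`

COR-CM (cell `pub-hodgecm2`, binder seat `b16` gen 63, count-neutral claim SHADOW IDEALS, file S6 — abstract same-slot
level, CM fields and realisations; theorems only, no definition, no named fact, no `sorry`).  NEW as stated, hence under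
`Summits/`.  HONEST FRAMING: statements about `dim MT(A_Φ × A_Ψ)` for two abelian varieties with complex multiplication
by the SAME field and about which Hodge classes on `A_Φ^a × A_Ψ^b` are sums of products; `HC_CM` is neither used nor
asserted.

The tree's `IrreducibleOddWeights` §3 / `IrreducibleOddWeightsCMFields` decided a pair of types `Φ, Ψ` of one field
UNDER (IRR) (`Anti` irreducible): additive iff no equivariant `L` carries `u_Ψ` to `u_Φ`.  The pivot of files S1–S5,
taken to be the slot itself (`Y = X`, `r = id`, `N = {1}`), removes the hypothesis:

* §1 **`IrrOdd.typeRank_sigmaType_add_card_eq_iff_not_exists_collision_of_sameSlot`** (ANY `G`-set `X`, any two CM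
  types for `ρ`): `rank(Φ, Ψ) + 2 = rank Φ + rank Ψ + 1` (`Hg(A_Φ × A_Ψ) = Hg(A_Φ) × Hg(A_Ψ)`) **iff no two
  `G`-equivariant endomorphisms `α, β` of `ℚ^X` have `α(u_Φ) = β(u_Ψ) ≠ 0`** (under (IRR): `β⁻¹α = L`).
* §2 ONE GALOIS CM FIELD `K` (`Aut(ℂ)` acts on `Hom(K, ℂ)` through the left regular action of `Gal(K/ℚ)`, the Hecke
  algebra is the right regular one): **`cmFamilyRank_add_card_eq_pair_iff_span_precomp_inf_eq_bot_of_isGalois`** —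
  `Hg(A_Φ × A_Ψ) = Hg(A_Φ) × Hg(A_Ψ)` **iff `span{u_Φ(·∘δ)} ∩ span{u_Ψ(·∘δ)} = 0`** (`δ ∈ Gal(K/ℚ)`): the RIGHT ideals
  `u_Φ ℚ[Γ]`, `u_Ψ ℚ[Γ]` meet in `0` — while the ranks themselves are the dimensions of the LEFT ideals `ℚ[Γ] u`.
  Unconditional half `cmFamilyRank_add_card_lt_of_span_precomp_inf_ne_bot_of_sameField` (any field).
* §3 ONE ABELIAN CM FIELD: **`cmFamilyRank_add_card_eq_pair_iff_forall_sum_mul_eq_zero_of_isAbelianGalois`** —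
  additive **iff `Σ_z u_Φ(z)·u_Ψ(z∘δ) = 0` for every `δ`**, i.e. iff `Φ` meets EVERY Galois translate `Ψδ` in exactly
  half of its places — COUNTING FORM **`…_iff_forall_two_mul_card_agree_eq_of_isAbelianGalois`**: `Φ` and
  `Ψ^δ = {z | z∘δ ∈ Ψ}` agree on exactly half of the embeddings, `2·#{z | z ∈ Φ ↔ z∘δ ∈ Ψ} = [K:ℚ]`, for every `δ`
  (`IrrOdd.sum_antiVec_one_mul_antiVec_one`: the correlation is `2·#agreements − [K:ℚ]`) — the character-free form of
  Kubota's Lemma 2 for pairs (no odd character with `χ(Φ) ≠ 0 ≠ χ(Ψ)`).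
* §4 `isNondegenerateFamily_iff_forall_of_cmFamilyRank_add_card_eq` (additive ⟹ (family nondegenerate ⟺ members
  nondegenerate); multi-field, recorded publicly), realisations: product-span iff's
  (`forall_hodgeClassesProductSpan_pair_iff_…_of_isGalois / _of_isAbelianGalois`) and **the Hodge conjecture on every
  `A_Φ^a × A_Ψ^b`** for NONDEGENERATE `Φ, Ψ` of a Galois field satisfying the criterion
  (`hodgeConjectureFor_prod_pair_of_span_precomp_inf_eq_bot`) — unconditionally.

## References

* [Kubota1965] T. Kubota, *On the field extension by complex multiplication*, Trans. AMS 118 (1965), §2 Lemma 2.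
* [Gordon1999HodgeAVSurvey] B. B. Gordon, *A survey of the Hodge conjecture for abelian varieties*, §3 Theorem (proof),
  7.5–7.7, 9.4.1, 10.10.
* [MoonenZarhin1999LowDim] B. Moonen, Yu. Zarhin, Math. Ann. 315 (1999), Thm. (0.1) (a), §3 (3.1).
* [Serre1977] J.-P. Serre, *Linear Representations of Finite Groups*, GTM 42, §2.2 Prop. 4, §3.3.
* [Shimura1998] G. Shimura, *Abelian Varieties with Complex Multiplication and Modular Functions*, §8.1.
-/

set_option autoImplicit false

noncomputable section

open scoped BigOperators Classical

open CategoryTheory CategoryTheory.Limits NumberField Module IntermediateField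

universe u v w

namespace Summit.HodgeConjecture.CorCM

/-! ### §1 Same slot set: the pivot is the slot itself -/

namespace IrrOdd

open Literature.NumberTheory.ComplexMultiplication

variable {G : Type w} [Group G] {I : Type u} {X : Type v} [MulAction G X] [DecidableEq I] [Fintype I] [Fintype X]
  [DecidableEq X]

omit [MulAction G X] [DecidableEq X] in
/-- The push-forward along the identity is the identity: `Σ_{x = y} u(x) = u(y)` (any decidability instance). [folklore] -/
theorem sum_filter_eq_apply (u : X → ℚ) (y : X) [DecidablePred fun x => x = y] :
    ∑ x ∈ Finset.univ.filter (fun x => x = y), u x = u y := by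
  rw [Finset.sum_filter, Finset.sum_eq_single y (fun x _ hx => if_neg hx) (fun hy => (hy (Finset.mem_univ y)).elim),
    if_pos rfl]

omit [DecidableEq X] in
/-- **The correlation of two type vectors counts agreements**: `Σ_x u_1(Φ)(x)·u_1(Ψ)(x) = 2·#{x | x ∈ Φ ↔ x ∈ Ψ} − |X|`
(`u = 2·𝟙 − 1` takes the value `+1` where `Φ`, `Ψ` agree and `−1` where they differ). [folklore] -/
theorem sum_antiVec_one_mul_antiVec_one (Φ Ψ : Set X) [DecidablePred fun x => x ∈ Φ ↔ x ∈ Ψ] :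
    ∑ x, antiVec Φ (1 : G) x * antiVec Ψ (1 : G) x =
      2 * ((Finset.univ.filter fun x => x ∈ Φ ↔ x ∈ Ψ).card : ℚ) - Fintype.card X := by
  classical
  have hterm : ∀ x, antiVec Φ (1 : G) x * antiVec Ψ (1 : G) x = 2 * (if (x ∈ Φ ↔ x ∈ Ψ) then 1 else 0) - 1 := by
    intro x
    simp only [antiVec]
    by_cases hΦ : x ∈ Φ <;> by_cases hΨ : x ∈ Ψ <;>
      simp only [translateInd_of_mem, translateInd_of_not_mem, hΦ, hΨ, one_smul, not_true_eq_false, not_false_eq_true,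
        iff_true, iff_false, if_true, if_false] <;> norm_num
  rw [Finset.sum_congr rfl fun x _ => hterm x, Finset.sum_sub_distrib, ← Finset.mul_sum, Finset.sum_boole,
    Finset.sum_const, Finset.card_univ, nsmul_eq_mul, mul_one]

variable [Nonempty I] [Nonempty X]

/-- **TWO TYPES ON ONE SLOT SET: additive iff no two equivariant endomorphisms of `ℚ^X` collide the type vectors.**
`I = {i₀, i₁}`, both slots the same `G`-set `X`, CM types `Φ_i` for `ρ`: `rank(Σ) + 2 = rank Φ_{i₀} + rank Φ_{i₁} + 1`
(`Hg(A₀ × A₁) = Hg(A₀) × Hg(A₁)`) **iff** there are NO `G`-equivariant `α, β ∈ End(ℚ^X)` with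
`α(u_1(Φ_{i₀})) = β(u_1(Φ_{i₁})) ≠ 0`.  No hypothesis on `X` (the tree's (IRR) criterion is the case where `β` may be
inverted on `Anti`). [cite: Gordon1999HodgeAVSurvey, §3 Theorem (proof) and 7.5–7.7] [cite: Serre1977, §2.2 Prop. 4] -/
theorem typeRank_sigmaType_add_card_eq_iff_not_exists_collision_of_sameSlot {ρ : G} {Φ : I → Set X}
    (h : ∀ i, IsCMTypeWith ρ (Φ i)) {i₀ i₁ : I} (hI : ∀ j, j = i₀ ∨ j = i₁) (h01 : i₀ ≠ i₁) :
    typeRank G (sigmaType (E := fun _ : I => X) Φ) + Fintype.card I = (∑ i, typeRank G (Φ i)) + 1 ↔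
      ¬ ∃ α β : (X → ℚ) →ₗ[ℚ] (X → ℚ),
        (∀ (g : G) (f : X → ℚ), α (fun y => f (g⁻¹ • y)) = fun y => α f (g⁻¹ • y)) ∧
        (∀ (g : G) (f : X → ℚ), β (fun y => f (g⁻¹ • y)) = fun y => β f (g⁻¹ • y)) ∧
        α (antiVec (Φ i₀) (1 : G)) = β (antiVec (Φ i₁) (1 : G)) ∧ α (antiVec (Φ i₀) (1 : G)) ≠ 0 := by
  have key := typeRank_sigmaType_add_card_eq_iff_not_exists_shadow_collision (E := fun _ : I => X) (Y := X) h hI h01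
    (fun x => x) (fun x => x) (fun _ _ => rfl) (fun _ _ => rfl) Function.surjective_id Function.surjective_id
    ({1} : Set G) (fun x x' hxx' => ⟨1, Set.mem_singleton _, by rw [one_smul]; exact hxx'⟩)
    (fun x x' hxx' => ⟨1, Set.mem_singleton _, by rw [one_smul]; exact hxx'⟩)
    (fun g hg => by rw [Set.mem_singleton_iff.1 hg]; exact Subgroup.one_mem _)
  simp only [sum_filter_eq_apply] at key
  exact key

end IrrOdd

open Literature.NumberTheory.ComplexMultiplication
open Literature.AlgebraicGeometry.Motives (AbelianVariety CMType)
open Literature.AlgebraicGeometry.Motives.AbelianVariety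
open Literature.AlgebraicGeometry.HodgeTheory
open Literature.AlgebraicGeometry.ComplexMultiplication (IsCMTypeRealisation)
open Literature.AlgebraicGeometry.Pohlmann1968

/-! ### §2 One Galois CM field -/

section Galois

variable {I : Type} [Fintype I] {K : Type} [Field K] [NumberField K] [IsCMField K]

/-- **A COMMON NON-ZERO HECKE COMBINATION OF THE TYPE VECTORS OBSTRUCTS `Hg(A_Φ × A_Ψ) = Hg(A_Φ) × Hg(A_Ψ)`** (one CM
field `K`, any; `δ` over `Aut(K)`): `span{u_Φ(·∘δ)} ∩ span{u_Ψ(·∘δ)} ≠ 0 ⟹ cmFamilyRank + 2 < cmTypeRank Φ + cmTypeRank Ψ + 1`.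
[cite: Gordon1999HodgeAVSurvey, §3 Theorem (proof) and 7.5] -/
theorem cmFamilyRank_add_card_lt_of_span_precomp_inf_ne_bot_of_sameField {i₀ i₁ : I} (h01 : i₀ ≠ i₁)
    (Φ : I → CMType K)
    (hne : Submodule.span ℚ (Set.range fun δ : K ≃ₐ[ℚ] K => fun z : K →+* ℂ =>
        antiVec (Φ i₀).1 (1 : ℂ ≃+* ℂ) (z.comp (δ : K →+* K))) ⊓
      Submodule.span ℚ (Set.range fun δ : K ≃ₐ[ℚ] K => fun z : K →+* ℂ =>
        antiVec (Φ i₁).1 (1 : ℂ ≃+* ℂ) (z.comp (δ : K →+* K))) ≠ ⊥) :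
    CMAlgebra.cmFamilyRank (K := fun _ : I => K) Φ + Fintype.card I < (∑ i, cmTypeRank (Φ i)) + 1 := by
  have key := cmFamilyRank_add_card_lt_of_span_precomp_shadow_inf_ne_bot (K := fun _ : I => K) h01 Φ (RingHom.id K)
    (RingHom.id K)
  simp only [RingHom.comp_id, IrrOdd.sum_filter_eq_apply] at key
  exact key hne

/-- **ONE GALOIS CM FIELD: `Hg(A_Φ × A_Ψ) = Hg(A_Φ) × Hg(A_Ψ)` iff the Hecke translates `u_Φ(·∘δ)`, `u_Ψ(·∘δ)`
(`δ ∈ Gal(K/ℚ)`) of the two type vectors span subspaces of `Anti(K)` meeting in `0`** — the right ideals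
`u_Φ ℚ[Gal]`, `u_Ψ ℚ[Gal]` meet in `0`.  No (IRR), (SC) or nondegeneracy hypothesis.
[cite: Gordon1999HodgeAVSurvey, §3 Theorem (proof), 7.5–7.7] [cite: Serre1977, §3.3] [cite: Shimura1998, §8.1] -/
theorem cmFamilyRank_add_card_eq_pair_iff_span_precomp_inf_eq_bot_of_isGalois [IsGalois ℚ K] {i₀ i₁ : I}
    (h01 : i₀ ≠ i₁) (hI : ∀ l, l = i₀ ∨ l = i₁) (Φ : I → CMType K) :
    CMAlgebra.cmFamilyRank (K := fun _ : I => K) Φ + Fintype.card I = (∑ i, cmTypeRank (Φ i)) + 1 ↔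
      Submodule.span ℚ (Set.range fun δ : K ≃ₐ[ℚ] K => fun z : K →+* ℂ =>
          antiVec (Φ i₀).1 (1 : ℂ ≃+* ℂ) (z.comp (δ : K →+* K))) ⊓
        Submodule.span ℚ (Set.range fun δ : K ≃ₐ[ℚ] K => fun z : K →+* ℂ =>
          antiVec (Φ i₁).1 (1 : ℂ ≃+* ℂ) (z.comp (δ : K →+* K))) = ⊥ := by
  obtain ⟨z₀⟩ : Nonempty (K →+* ℂ) := inferInstance
  have key := cmFamilyRank_add_card_eq_pair_iff_span_precomp_shadow_inf_eq_bot (K := fun _ : I => K) h01 hI Φ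
    (RingHom.id K) (RingHom.id K) z₀ (fun z _ hz => normalClosure_le_range_of_normal z₀ hz)
  simp only [RingHom.comp_id, IrrOdd.sum_filter_eq_apply] at key
  exact key

end Galois

/-! ### §3 One abelian CM field -/

section Abelian

variable {I : Type} [Fintype I] {K : Type} [Field K] [NumberField K] [IsCMField K]

/-- **ONE ABELIAN CM FIELD: a single non-zero correlation `Σ_z u_Φ(z)·u_Ψ(z∘δ) ≠ 0` obstructs
`Hg(A_Φ × A_Ψ) = Hg(A_Φ) × Hg(A_Ψ)`** — e.g. `δ = 1`, `Φ = Ψ`: the sum is `[K:ℚ]`. [cite: Kubota1965, §2 Lemma 2]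
[cite: Gordon1999HodgeAVSurvey, 7.5 and 9.4.1] -/
theorem cmFamilyRank_add_card_lt_of_sum_mul_ne_zero_of_isAbelianGalois [IsAbelianGalois ℚ K] {i₀ i₁ : I}
    (h01 : i₀ ≠ i₁) (Φ : I → CMType K) {δ : K ≃ₐ[ℚ] K}
    (hδ : ∑ z : K →+* ℂ, antiVec (Φ i₀).1 (1 : ℂ ≃+* ℂ) z * antiVec (Φ i₁).1 (1 : ℂ ≃+* ℂ) (z.comp (δ : K →+* K)) ≠ 0) :
    CMAlgebra.cmFamilyRank (K := fun _ : I => K) Φ + Fintype.card I < (∑ i, cmTypeRank (Φ i)) + 1 := by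
  have key := cmFamilyRank_add_card_lt_of_sum_shadow_mul_ne_zero (K := fun _ : I => K) h01 Φ (RingHom.id K)
    (RingHom.id K) (δ := δ)
  simp only [RingHom.comp_id, IrrOdd.sum_filter_eq_apply] at key
  exact key hδ

/-- **ONE ABELIAN CM FIELD: `Hg(A_Φ × A_Ψ) = Hg(A_Φ) × Hg(A_Ψ)` iff `Σ_z u_Φ(z)·u_Ψ(z∘δ) = 0` for EVERY
`δ ∈ Gal(K/ℚ)`** — `Φ` meets every Galois translate `Ψδ` in exactly half of its places (`u = 2·𝟙 − 1`: the sum is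
`4·|Φ ∩ Ψδ| − [K:ℚ]`); the character-free form of Kubota's Lemma 2 for a PAIR (no odd character `χ` with
`χ(Φ) ≠ 0 ≠ χ(Ψ)`). [cite: Kubota1965, §2 Lemma 2] [cite: Gordon1999HodgeAVSurvey, §3 Theorem, 7.5–7.7 and 9.4.1] -/
theorem cmFamilyRank_add_card_eq_pair_iff_forall_sum_mul_eq_zero_of_isAbelianGalois [IsAbelianGalois ℚ K] {i₀ i₁ : I}
    (h01 : i₀ ≠ i₁) (hI : ∀ l, l = i₀ ∨ l = i₁) (Φ : I → CMType K) :
    CMAlgebra.cmFamilyRank (K := fun _ : I => K) Φ + Fintype.card I = (∑ i, cmTypeRank (Φ i)) + 1 ↔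
      ∀ δ : K ≃ₐ[ℚ] K,
        ∑ z : K →+* ℂ, antiVec (Φ i₀).1 (1 : ℂ ≃+* ℂ) z * antiVec (Φ i₁).1 (1 : ℂ ≃+* ℂ) (z.comp (δ : K →+* K)) = 0 := by
  obtain ⟨z₀⟩ : Nonempty (K →+* ℂ) := inferInstance
  have key := cmFamilyRank_add_card_eq_pair_iff_forall_sum_shadow_mul_eq_zero (K := fun _ : I => K) h01 hI Φ
    (RingHom.id K) (RingHom.id K) z₀ (fun z _ hz => normalClosure_le_range_of_normal z₀ hz)
  simp only [RingHom.comp_id, IrrOdd.sum_filter_eq_apply] at key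
  exact key

/-- **COUNTING FORM for one ABELIAN CM field: `Hg(A_Φ × A_Ψ) = Hg(A_Φ) × Hg(A_Ψ)` iff for every `δ ∈ Gal(K/ℚ)` the types
`Φ` and `Ψ^δ = {z | z∘δ ∈ Ψ}` AGREE ON EXACTLY HALF of the embeddings**: `2·#{z | z ∈ Φ ↔ z∘δ ∈ Ψ} = [K:ℚ]`.  (E.g. `K`
imaginary quadratic: never; `δ = 1`, `Ψ = Φ̄`: zero agreements.) [cite: Kubota1965, §2 Lemma 2]
[cite: Gordon1999HodgeAVSurvey, 7.5–7.7 and 9.4.1] -/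
theorem cmFamilyRank_add_card_eq_pair_iff_forall_two_mul_card_agree_eq_of_isAbelianGalois [IsAbelianGalois ℚ K]
    {i₀ i₁ : I} (h01 : i₀ ≠ i₁) (hI : ∀ l, l = i₀ ∨ l = i₁) (Φ : I → CMType K) :
    CMAlgebra.cmFamilyRank (K := fun _ : I => K) Φ + Fintype.card I = (∑ i, cmTypeRank (Φ i)) + 1 ↔
      ∀ δ : K ≃ₐ[ℚ] K,
        2 * (Finset.univ.filter fun z : K →+* ℂ => z ∈ (Φ i₀).1 ↔ z.comp (δ : K →+* K) ∈ (Φ i₁).1).card =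
          Module.finrank ℚ K := by
  rw [cmFamilyRank_add_card_eq_pair_iff_forall_sum_mul_eq_zero_of_isAbelianGalois h01 hI Φ]
  refine forall_congr' fun δ => ?_
  have hpre : ∀ z : K →+* ℂ, antiVec (Φ i₁).1 (1 : ℂ ≃+* ℂ) (z.comp (δ : K →+* K)) =
      antiVec {z : K →+* ℂ | z.comp (δ : K →+* K) ∈ (Φ i₁).1} (1 : ℂ ≃+* ℂ) z := fun z => by
    simp only [antiVec, translateInd, one_smul, Set.mem_setOf_eq]
  simp only [hpre]
  rw [IrrOdd.sum_antiVec_one_mul_antiVec_one (G := ℂ ≃+* ℂ), sub_eq_zero, ← Embeddings.card K ℂ]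
  simp only [Set.mem_setOf_eq]
  exact_mod_cast Iff.rfl

end Abelian

/-! ### §4 Nondegeneracy and realisations -/

section Hodge

variable {I : Type} [Fintype I] {K : I → Type} [∀ i, Field (K i)] [∀ i, NumberField (K i)] [∀ i, IsCMField (K i)]

omit [∀ i, IsCMField (K i)] in
/-- `|⊔_i Hom(K_i, ℂ)| = Σ_i [K_i : ℚ]`. [folklore] -/
private theorem card_sigma_ringHom_eq_sum_finrank :
    Fintype.card ((i : I) × (K i →+* ℂ)) = ∑ i, Module.finrank ℚ (K i) := by
  rw [Fintype.card_sigma]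
  exact Finset.sum_congr rfl fun i _ => Embeddings.card (K i) ℂ

/-- **Under rank additivity the family is nondegenerate iff every member is** (`rank Φ_i − 1 ≤ [K_i:ℚ]/2` termwise; any
CM fields). [cite: Gordon1999HodgeAVSurvey, 7.5–7.6.1] -/
theorem isNondegenerateFamily_iff_forall_of_cmFamilyRank_add_card_eq [Nonempty I] (Φ : ∀ i, CMType (K i))
    (hsum : CMAlgebra.cmFamilyRank Φ + Fintype.card I = (∑ i, cmTypeRank (Φ i)) + 1) :
    CMAlgebra.IsNondegenerateFamily Φ ↔ ∀ i, IsNondegenerate (Φ i) := by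
  have hle : ∀ i, cmTypeRank (Φ i) ≤ Module.finrank ℚ (K i) / 2 + 1 := fun i => cmTypeRank_le (Φ i)
  have hdiv : (∑ i, Module.finrank ℚ (K i)) / 2 = ∑ i, Module.finrank ℚ (K i) / 2 := by
    rw [← card_sigma_ringHom_eq_sum_finrank (K := K),
      card_sigma_div_two (G := ℂ ≃+* ℂ) (E := fun i => K i →+* ℂ) (fun i => isCMTypeWith_conj (Φ i))]
    exact Finset.sum_congr rfl fun i _ => by rw [Embeddings.card (K i) ℂ]
  have htot : ∑ j, (Module.finrank ℚ (K j) / 2 + 1) = (∑ j, Module.finrank ℚ (K j) / 2) + Fintype.card I := by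
    rw [Finset.sum_add_distrib, Finset.sum_const, Finset.card_univ, smul_eq_mul, mul_one]
  have hnd : ∀ i, IsNondegenerate (Φ i) ↔ cmTypeRank (Φ i) = Module.finrank ℚ (K i) / 2 + 1 := fun i =>
    isNondegenerate_iff (Φ i)
  rw [CMAlgebra.isNondegenerateFamily_iff, hdiv]
  simp only [hnd]
  constructor
  · intro hS i
    by_contra hne
    have hlt : cmTypeRank (Φ i) < Module.finrank ℚ (K i) / 2 + 1 := lt_of_le_of_ne (hle i) hne
    have hsum_lt : ∑ j, cmTypeRank (Φ j) < ∑ j, (Module.finrank ℚ (K j) / 2 + 1) :=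
      Finset.sum_lt_sum (fun j _ => hle j) ⟨i, Finset.mem_univ i, hlt⟩
    rw [htot] at hsum_lt
    omega
  · intro hall
    have hsum_eq : ∑ j, cmTypeRank (Φ j) = ∑ j, (Module.finrank ℚ (K j) / 2 + 1) :=
      Finset.sum_congr rfl fun j _ => hall j
    rw [htot] at hsum_eq
    omega

variable {L : Type} [Field L] [NumberField L] [IsCMField L] {Ψ : I → CMType L} {A : I → AbelianVariety ℂ}
  {ιA : ∀ i, 𝓞 L →+* End (A i)} {θ : ∀ i, L →+* Module.End ℂ (complexBetti (A i).X 1)}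

/-- **One Galois CM field: every Hodge class on every `A_Φ^a × A_Ψ^b` is a sum of products ⟺ the Hecke criterion.**
[cite: MoonenZarhin1999LowDim, §3 (3.1)] [cite: Gordon1999HodgeAVSurvey, 7.5–7.7] -/
theorem forall_hodgeClassesProductSpan_pair_iff_span_precomp_inf_eq_bot_of_isGalois [IsGalois ℚ L] {i₀ i₁ : I}
    (h01 : i₀ ≠ i₁) (hI : ∀ l, l = i₀ ∨ l = i₁)
    (hA : ∀ i, IsCMTypeRealisation (Ψ i) (A i) (ιA i) (θ i)) :
    (∀ (N₁ N₂ : ℕ) [NeZero N₁] [NeZero N₂] (π₁ : Fin N₁ → I) (π₂ : Fin N₂ → I), (∀ l₁ l₂, π₁ l₁ ≠ π₂ l₂) →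
        HodgeClassesProductSpan (⨁ fun l => A (π₁ l)) (⨁ fun l => A (π₂ l))) ↔
      Submodule.span ℚ (Set.range fun δ : L ≃ₐ[ℚ] L => fun z : L →+* ℂ =>
          antiVec (Ψ i₀).1 (1 : ℂ ≃+* ℂ) (z.comp (δ : L →+* L))) ⊓
        Submodule.span ℚ (Set.range fun δ : L ≃ₐ[ℚ] L => fun z : L →+* ℂ =>
          antiVec (Ψ i₁).1 (1 : ℂ ≃+* ℂ) (z.comp (δ : L →+* L))) = ⊥ := by
  haveI : Nonempty I := ⟨i₀⟩
  exact (cmFamilyRank_add_card_eq_iff_forall_hodgeClassesProductSpan (K := fun _ : I => L) hA).symm.trans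
    (cmFamilyRank_add_card_eq_pair_iff_span_precomp_inf_eq_bot_of_isGalois h01 hI Ψ)

/-- **One abelian CM field: every Hodge class on every `A_Φ^a × A_Ψ^b` is a sum of products ⟺ `Σ_z u_Φ(z)·u_Ψ(z∘δ) = 0`
for every `δ`.** [cite: MoonenZarhin1999LowDim, §3 (3.1)] [cite: Kubota1965, §2 Lemma 2] -/
theorem forall_hodgeClassesProductSpan_pair_iff_forall_sum_mul_eq_zero_of_isAbelianGalois [IsAbelianGalois ℚ L]
    {i₀ i₁ : I} (h01 : i₀ ≠ i₁) (hI : ∀ l, l = i₀ ∨ l = i₁)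
    (hA : ∀ i, IsCMTypeRealisation (Ψ i) (A i) (ιA i) (θ i)) :
    (∀ (N₁ N₂ : ℕ) [NeZero N₁] [NeZero N₂] (π₁ : Fin N₁ → I) (π₂ : Fin N₂ → I), (∀ l₁ l₂, π₁ l₁ ≠ π₂ l₂) →
        HodgeClassesProductSpan (⨁ fun l => A (π₁ l)) (⨁ fun l => A (π₂ l))) ↔
      ∀ δ : L ≃ₐ[ℚ] L,
        ∑ z : L →+* ℂ, antiVec (Ψ i₀).1 (1 : ℂ ≃+* ℂ) z * antiVec (Ψ i₁).1 (1 : ℂ ≃+* ℂ) (z.comp (δ : L →+* L)) = 0 := by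
  haveI : Nonempty I := ⟨i₀⟩
  exact (cmFamilyRank_add_card_eq_iff_forall_hodgeClassesProductSpan (K := fun _ : I => L) hA).symm.trans
    (cmFamilyRank_add_card_eq_pair_iff_forall_sum_mul_eq_zero_of_isAbelianGalois h01 hI Ψ)

/-- **THE HODGE CONJECTURE ON EVERY `A_Φ^a × A_Ψ^b`** (every `⨁_{j<N} A_{π j}`) for two abelian varieties with CM by one
GALOIS field whose types are NONDEGENERATE and satisfy the Hecke criterion `span{u_Φ(·∘δ)} ∩ span{u_Ψ(·∘δ)} = 0` —
UNCONDITIONALLY (the family is then nondegenerate). [cite: Gordon1999HodgeAVSurvey, 7.5 and 10.10] -/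
theorem hodgeConjectureFor_prod_pair_of_span_precomp_inf_eq_bot [IsGalois ℚ L] {i₀ i₁ : I} (h01 : i₀ ≠ i₁)
    (hI : ∀ l, l = i₀ ∨ l = i₁) (hnd : ∀ i, IsNondegenerate (Ψ i))
    (hbot : Submodule.span ℚ (Set.range fun δ : L ≃ₐ[ℚ] L => fun z : L →+* ℂ =>
          antiVec (Ψ i₀).1 (1 : ℂ ≃+* ℂ) (z.comp (δ : L →+* L))) ⊓
        Submodule.span ℚ (Set.range fun δ : L ≃ₐ[ℚ] L => fun z : L →+* ℂ =>
          antiVec (Ψ i₁).1 (1 : ℂ ≃+* ℂ) (z.comp (δ : L →+* L))) = ⊥)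
    (hA : ∀ i, IsCMTypeRealisation (Ψ i) (A i) (ιA i) (θ i)) {N : ℕ} (π : Fin N → I) :
    HodgeConjectureFor (⨁ fun j : Fin N => A (π j)).dim (⨁ fun j : Fin N => A (π j)).X := by
  haveI : Nonempty I := ⟨i₀⟩
  have hfam : CMAlgebra.IsNondegenerateFamily (K := fun _ : I => L) Ψ :=
    (isNondegenerateFamily_iff_forall_of_cmFamilyRank_add_card_eq (K := fun _ : I => L) Ψ
      ((cmFamilyRank_add_card_eq_pair_iff_span_precomp_inf_eq_bot_of_isGalois h01 hI Ψ).2 hbot)).2 hnd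
  exact hfam.hodgeConjectureFor_prod (K := fun _ : I => L) hA π

end Hodge

end Summit.HodgeConjecture.CorCM

end
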